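import Mathlib
import Summits.Ventures.LatticeQCDFlow.Scaling.U1AtomicMoments

/-!
# LatticeQCDFlow / Scaling — `U(1)` on the torus: the cube moment
# `E[Re U_top · Re U_bot · ∏_{lateral} Re U_ℓ] = 1/32`

HONEST FRAMING: exact (Metropolis-corrected) sampling algorithms for lattice gauge theory;
figures of merit are autocorrelation/cost numbers at stated couplings and volumes; no
continuum-physics claim.

Venture `LatticeQCDFlow` (cell pub-lqcd), topic `Scaling`, FANOUT row 30 (lean-1) — OUR WORK, the
lattice half of the leading-coefficient identity (LC) of theory2 item 120
(HOME/lean/theory2/LANDING.md §32), part 2: the ONE connected term.  For the unit cube between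
`bot = (−e_a; i, j)` and `top = (0; i, j)` with lateral faces `(−e_a; i, a)`, `(−e_a + e_j; i, a)`,
`(−e_a; j, a)`, `(−e_a + e_i; j, a)`:
* `holT_top_eq_prod` — the abelian Bianchi identity: `U_top` is the alternating product of `U_bot`
  and the four lateral holonomies (the boundary of the cube is closed);
* `integral_prod_reZpow_five` — peeling the four lateral faces through their top bonds (each
  private once `top` is eliminated) and then `bot`: `∫ ∏_f Re(U_f) U_f^{±1} dν = (1/2)⁵`
  (`∫ Re z · z^{±1} dHaar = 1/2`);
* **`integral_cube_eq`** — `E[X · Y · c_I c_I' c_J c_J'] = 1/32 = 2^{-(4t+1)}` at `t = 1`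
  [cite: MontvayMunster1994, §3.6.2 (3.437)] (`Re U_top = (U_top + U_top⁻¹)/2` and the two
  alternating products).
Elementary; nothing is cited as a fact; one `def` (`reZpow`), no `sorry`.
-/

noncomputable section

open MeasureTheory Filter Topology Finset
open Literature.MathematicalPhysics.QuantumFieldTheory
open Summit.Ventures.LatticeQCDFlow.Theory2.Lattice.TorusGeom

namespace Summit.Ventures.LatticeQCDFlow.Theory2.Lattice.U1Torus

variable {d L : ℕ}

/-! ## §1. The Bianchi identity of the cube -/

/-- **Bianchi identity (abelian)**: with `v = −e_a`,
`U_(0;i,j) = U_(v;i,j) · U_(v;i,a)⁻¹ · U_(v+e_j;i,a) · U_(v;j,a) · U_(v+e_i;j,a)⁻¹`. [folklore] -/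
theorem holT_top_eq_prod (i j a : Fin d) (U : ZdGaugeConfig d Circle) :
    holT L (top i j) U =
      holT L (bot i j a) U * (holT L (-Pi.single a 1, i, a) U)⁻¹ *
        holT L (-Pi.single a 1 + Pi.single j 1, i, a) U * holT L (-Pi.single a 1, j, a) U *
        (holT L (-Pi.single a 1 + Pi.single i 1, j, a) U)⁻¹ := by
  have s1 : (-Pi.single a 1 + Pi.single a 1 : Site d L) = 0 := neg_add_cancel _
  have s2 : (-Pi.single a 1 + Pi.single j 1 + Pi.single a 1 : Site d L) = 0 + Pi.single j 1 := by abel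
  have s3 : (-Pi.single a 1 + Pi.single i 1 + Pi.single a 1 : Site d L) = 0 + Pi.single i 1 := by abel
  have s4 : (-Pi.single a 1 + Pi.single j 1 + Pi.single i 1 : Site d L) =
      -Pi.single a 1 + Pi.single i 1 + Pi.single j 1 := by abel
  apply Circle.coe_injective
  simp only [holT, top, bot, plaquetteHolonomy, torusSigma_apply, Site.shift, s1, s2, s3, s4,
    Circle.coe_mul, Circle.coe_inv]
  field_simp

/-! ## §2. The factors `Re(w) w^{η}` and the five-fold peeling -/

/-- `Re(w) · w^{η}` as a complex number. [folklore] -/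
def reZpow (η : ℤ) (w : Circle) : ℂ := ((w : ℂ).re : ℂ) * (w : ℂ) ^ η

/-- `reZpow η` is continuous. [folklore] -/
theorem continuous_reZpow (η : ℤ) : Continuous (reZpow η) := by
  unfold reZpow
  exact (Complex.continuous_ofReal.comp (Complex.continuous_re.comp continuous_subtype_val)).mul
    ((continuous_subtype_val (p := fun z : ℂ => z ∈ Submonoid.unitSphere ℂ)).zpow₀ η
      fun z => Or.inl (Circle.coe_ne_zero z))

/-- `‖Re(w) w^{η}‖ ≤ 1`. [folklore] -/
theorem norm_reZpow_le (η : ℤ) (w : Circle) : ‖reZpow η w‖ ≤ 1 := by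
  unfold reZpow
  rw [norm_mul, norm_zpow, Circle.norm_coe, one_zpow, mul_one, Complex.norm_real, Real.norm_eq_abs]
  exact (Complex.abs_re_le_norm _).trans (le_of_eq (Circle.norm_coe _))

/-- `∫ Re(z) z^{η} dHaar = 1/2` for `η = ±1`. [folklore] -/
theorem integral_reZpow {η : ℤ} (hη : η = 1 ∨ η = -1) :
    ∫ z, reZpow η z ∂(haarProbability Circle) = 1 / 2 := by
  unfold reZpow
  rcases hη with rfl | rfl
  · simp only [zpow_one]; exact integral_re_mul_self
  · simp only [zpow_neg, zpow_one]; exact integral_re_mul_inv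

section Peel

variable [NeZero L] {i j a : Fin d}

/-- The holonomy of `r` ignores the bond variables off `r`. [folklore] -/
theorem holT_mulSingle_of_not_mem {r : TPlaq d L} {b : Edge d L} (hb : b ∉ r.tbonds)
    (z : Circle) (U : ZdGaugeConfig d Circle) :
    holT L r (Pi.mulSingle (torusSect L b) z * U) = holT L r U := by
  have hne : ∀ b' ∈ r.tbonds, torusSect L b' ≠ torusSect L b := fun b' hb' h =>
    hb (torusSect_injective h ▸ hb')
  exact holT_mulSingle_of_forall_ne (hne _ (by simp [TPlaq.tbonds])) (hne _ (by simp [TPlaq.tbonds]))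
    (hne _ (by simp [TPlaq.tbonds])) (hne _ (by simp [TPlaq.tbonds])) z U

/-- The third bond `(y + e_a, m)` of the lateral label `(y; m, a)` multiplies its holonomy by
`z⁻¹`. [folklore] -/
theorem holT_lat_mulSingle_thd (hL : 2 ≤ L) {y : Site d L} {m : Fin d} (hma : m ≠ a)
    (z : Circle) (U : ZdGaugeConfig d Circle) :
    holT L (y, m, a) (Pi.mulSingle (torusSect L (y + Pi.single a 1, m)) z * U) =
      z ^ (-1 : ℤ) * holT L (y, m, a) U := by
  obtain ⟨-, n13, -, n23, -, n34⟩ := tbonds_pairwise_ne hL (x := y) hma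
  rw [zpow_neg, zpow_one]
  exact holT_mulSingle_eq_inv_mul_of_thd n13 n23 n34.symm z U

omit [NeZero L] in
/-- A bond of direction `n ∉ {m, a}` is not a bond of `(y; m, a)`. [folklore] -/
theorem not_mem_tbonds_of_dir {y s : Site d L} {m n : Fin d} (hnm : n ≠ m) (hna : n ≠ a) :
    ((s, n) : Edge d L) ∉ TPlaq.tbonds ((y, m, a) : TPlaq d L) := fun h => by
  rcases dir_of_mem_tbonds h with h | h
  · exact hnm h
  · exact hna h

omit [NeZero L] in
/-- A bond `(s, m)` with `s ∉ {y, y + e_a}` is not a bond of `(y; m, a)` (`m ≠ a`). [folklore] -/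
theorem not_mem_tbonds_of_site {y s : Site d L} {m : Fin d} (hma : m ≠ a) (h1 : s ≠ y)
    (h2 : s ≠ y + Pi.single a 1) : ((s, m) : Edge d L) ∉ TPlaq.tbonds ((y, m, a) : TPlaq d L) :=
  fun h => by
    rcases site_of_mem_tbonds_fst hma h with h | h
    · exact h1 h
    · exact h2 h

omit [NeZero L] in
/-- A bond at `a`-height `0` is not a bond of `bot`. [folklore] -/
theorem not_mem_tbonds_bot_of_height (hL : 2 ≤ L) (hai : a ≠ i) (haj : a ≠ j) {b : Edge d L}
    (hb : b.1 a = 0) : b ∉ (bot (L := L) i j a).tbonds := fun h => by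
  have := (apply_a_of_mem_tbonds_bot hai haj h).1
  rw [hb] at this
  exact zero_ne_neg_one hL this

/-- One peeling step with the factor `Re(U_q) U_q^{η}`. [folklore] -/
theorem integral_mul_reZpow_holT (q : TPlaq d L) (e : ZdEdge d)
    (hhol : ∀ z U, holT L q (Pi.mulSingle e z * U) = z ^ (-1 : ℤ) * holT L q U)
    {G : ZdGaugeConfig d Circle → ℂ} (hGc : Continuous G) (hGb : ∀ U, ‖G U‖ ≤ 1)
    (hGinv : ∀ z U, G (Pi.mulSingle e z * U) = G U) {η : ℤ} (hη : η = 1 ∨ η = -1) :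
    ∫ U, G U * reZpow η (holT L q U) ∂(zdHaar d Circle) = (∫ U, G U ∂(zdHaar d Circle)) * (1 / 2) := by
  rw [integral_mul_comp_holT_eq_mul_integral q e (Or.inr rfl) hhol hGc.measurable hGb hGinv
    (continuous_reZpow η), integral_reZpow hη]

/-- **The five-fold peeling**: for signs `η_f = ±1`,
`∫ ∏_{f ∈ {bot, I, I', J, J'}} Re(U_f) U_f^{η_f} dν = (1/2)⁵`. [folklore] -/
theorem integral_prod_reZpow_five (hL : 3 ≤ L) (hij : i < j) (hai : a ≠ i) (haj : a ≠ j)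
    {η₀ η₁ η₂ η₃ η₄ : ℤ} (h₀ : η₀ = 1 ∨ η₀ = -1) (h₁ : η₁ = 1 ∨ η₁ = -1) (h₂ : η₂ = 1 ∨ η₂ = -1)
    (h₃ : η₃ = 1 ∨ η₃ = -1) (h₄ : η₄ = 1 ∨ η₄ = -1) :
    ∫ U, reZpow η₀ (holT L (bot i j a) U) * reZpow η₁ (holT L (-Pi.single a 1, i, a) U) *
        reZpow η₂ (holT L (-Pi.single a 1 + Pi.single j 1, i, a) U) *
        reZpow η₃ (holT L (-Pi.single a 1, j, a) U) *
        reZpow η₄ (holT L (-Pi.single a 1 + Pi.single i 1, j, a) U) ∂(zdHaar d Circle) =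
      1 / 32 := by
  have hL2 : 2 ≤ L := by omega
  have hia : i ≠ a := Ne.symm hai
  have hja : j ≠ a := Ne.symm haj
  have hji : j ≠ i := Fin.ne_of_gt hij
  have hijne : i ≠ j := Fin.ne_of_lt hij
  -- notation
  set v : Site d L := -Pi.single a 1 with hv
  -- site facts
  have hv0 : v + Pi.single a 1 = 0 := neg_add_cancel _
  -- continuity / bounds of the factors
  have cF : ∀ (η : ℤ) (q : TPlaq d L), Continuous fun U => reZpow η (holT L q U) :=
    fun η q => (continuous_reZpow η).comp (continuous_holT L q)
  have bF : ∀ (η : ℤ) (q : TPlaq d L) (U : ZdGaugeConfig d Circle), ‖reZpow η (holT L q U)‖ ≤ 1 :=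
    fun η q U => norm_reZpow_le η _
  have bmul : ∀ {x y : ℂ}, ‖x‖ ≤ 1 → ‖y‖ ≤ 1 → ‖x * y‖ ≤ 1 := fun hx hy => by
    rw [norm_mul]; exact mul_le_one₀ hx (norm_nonneg _) hy
  -- Step 5: `∫ Re(U_bot) U_bot^{η₀} = 1/2` (peel `bot` through its first bond)
  have I5 : ∫ U, reZpow η₀ (holT L (bot i j a) U) ∂(zdHaar d Circle) = 1 / 2 := by
    obtain ⟨n12, n13, n14, -, -, -⟩ := tbonds_pairwise_ne hL2 (x := v) hijne
    have hhol : ∀ z U, holT L (bot i j a) (Pi.mulSingle (torusSect L (v, i)) z * U) =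
        z ^ (1 : ℤ) * holT L (bot i j a) U := fun z U => by
      rw [zpow_one]; exact holT_mulSingle_eq_mul_of_fst n12.symm n13.symm n14.symm z U
    have h := integral_mul_comp_holT_eq_mul_integral (𝕜 := ℂ) (bot (L := L) i j a)
      (torusSect L (v, i)) (Or.inl rfl) hhol (G := fun _ => (1 : ℂ)) measurable_const (K := 1)
      (fun _ => by simp) (fun _ _ => rfl) (continuous_reZpow η₀)
    simp only [one_mul, integral_const, probReal_univ, one_smul] at h
    rw [h, integral_reZpow h₀]
  -- Step 4: peel `I = (v; i, a)` through its third bond `(v + e_a, i)` (a bond of height 0)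
  have I4 : ∫ U, reZpow η₀ (holT L (bot i j a) U) * reZpow η₁ (holT L (v, i, a) U)
      ∂(zdHaar d Circle) = 1 / 4 := by
    have hb : ((v + Pi.single a 1, i) : Edge d L) ∉ (bot (L := L) i j a).tbonds :=
      not_mem_tbonds_bot_of_height hL2 hai haj (show (v + Pi.single a 1 : Site d L) a = 0 by rw [hv0]; rfl)
    rw [integral_mul_reZpow_holT (v, i, a) _ (holT_lat_mulSingle_thd hL2 hia)
      (G := fun U => reZpow η₀ (holT L (bot i j a) U)) (cF η₀ (bot i j a)) (bF η₀ (bot i j a))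
      (fun z U => by simp only [holT_mulSingle_of_not_mem hb]) h₁, I5]
    norm_num
  -- Step 3: peel `I' = (v + e_j; i, a)` through its third bond `(v + e_j + e_a, i)`
  have I3 : ∫ U, reZpow η₀ (holT L (bot i j a) U) * reZpow η₁ (holT L (v, i, a) U) *
      reZpow η₂ (holT L (v + Pi.single j 1, i, a) U) ∂(zdHaar d Circle) = 1 / 8 := by
    have hs : v + Pi.single j 1 + Pi.single a 1 = Pi.single j 1 := by
      rw [add_right_comm, hv0, zero_add]
    have hb0 : ((v + Pi.single j 1 + Pi.single a 1, i) : Edge d L) ∉ (bot (L := L) i j a).tbonds :=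
      not_mem_tbonds_bot_of_height hL2 hai haj
        (show (v + Pi.single j 1 + Pi.single a 1 : Site d L) a = 0 by rw [hs]; exact Pi.single_eq_of_ne haj _)
    have hb1 : ((v + Pi.single j 1 + Pi.single a 1, i) : Edge d L) ∉
        TPlaq.tbonds ((v, i, a) : TPlaq d L) := by
      refine not_mem_tbonds_of_site hia ?_ ?_
      · rw [hs]; intro h
        exact single_add_single_ne_zero hL j a (by rw [h, hv]; exact neg_add_cancel _)
      · rw [hs, hv0]; exact single_ne_zero hL2 j
    rw [integral_mul_reZpow_holT (v + Pi.single j 1, i, a) _ (holT_lat_mulSingle_thd hL2 hia)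
      (G := fun U => reZpow η₀ (holT L (bot i j a) U) * reZpow η₁ (holT L (v, i, a) U))
      ((cF η₀ (bot i j a)).mul (cF η₁ (v, i, a)))
      (fun U => bmul (bF η₀ (bot i j a) U) (bF η₁ (v, i, a) U))
      (fun z U => by simp only [holT_mulSingle_of_not_mem hb0, holT_mulSingle_of_not_mem hb1]) h₂,
      I4]
    norm_num
  -- Step 2: peel `J = (v; j, a)` through its third bond `(v + e_a, j)`
  have I2 : ∫ U, reZpow η₀ (holT L (bot i j a) U) * reZpow η₁ (holT L (v, i, a) U) *
      reZpow η₂ (holT L (v + Pi.single j 1, i, a) U) * reZpow η₃ (holT L (v, j, a) U)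
      ∂(zdHaar d Circle) = 1 / 16 := by
    have hb0 : ((v + Pi.single a 1, j) : Edge d L) ∉ (bot (L := L) i j a).tbonds :=
      not_mem_tbonds_bot_of_height hL2 hai haj (show (v + Pi.single a 1 : Site d L) a = 0 by rw [hv0]; rfl)
    have hb1 : ((v + Pi.single a 1, j) : Edge d L) ∉ TPlaq.tbonds ((v, i, a) : TPlaq d L) :=
      not_mem_tbonds_of_dir hji hja
    have hb2 : ((v + Pi.single a 1, j) : Edge d L) ∉
        TPlaq.tbonds ((v + Pi.single j 1, i, a) : TPlaq d L) := not_mem_tbonds_of_dir hji hja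
    rw [integral_mul_reZpow_holT (v, j, a) _ (holT_lat_mulSingle_thd hL2 hja)
      (G := fun U => reZpow η₀ (holT L (bot i j a) U) * reZpow η₁ (holT L (v, i, a) U) *
        reZpow η₂ (holT L (v + Pi.single j 1, i, a) U))
      (((cF η₀ (bot i j a)).mul (cF η₁ (v, i, a))).mul (cF η₂ (v + Pi.single j 1, i, a)))
      (fun U => bmul (bmul (bF η₀ (bot i j a) U) (bF η₁ (v, i, a) U)) (bF η₂ (v + Pi.single j 1, i, a) U))
      (fun z U => by simp only [holT_mulSingle_of_not_mem hb0, holT_mulSingle_of_not_mem hb1,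
        holT_mulSingle_of_not_mem hb2]) h₃, I3]
    norm_num
  -- Step 1: peel `J' = (v + e_i; j, a)` through its third bond `(v + e_i + e_a, j)`
  have hs : v + Pi.single i 1 + Pi.single a 1 = Pi.single i 1 := by
    rw [add_right_comm, hv0, zero_add]
  have hb0 : ((v + Pi.single i 1 + Pi.single a 1, j) : Edge d L) ∉ (bot (L := L) i j a).tbonds :=
    not_mem_tbonds_bot_of_height hL2 hai haj
      (show (v + Pi.single i 1 + Pi.single a 1 : Site d L) a = 0 by rw [hs]; exact Pi.single_eq_of_ne hai _)
  have hb1 : ((v + Pi.single i 1 + Pi.single a 1, j) : Edge d L) ∉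
      TPlaq.tbonds ((v, i, a) : TPlaq d L) := not_mem_tbonds_of_dir hji hja
  have hb2 : ((v + Pi.single i 1 + Pi.single a 1, j) : Edge d L) ∉
      TPlaq.tbonds ((v + Pi.single j 1, i, a) : TPlaq d L) := not_mem_tbonds_of_dir hji hja
  have hb3 : ((v + Pi.single i 1 + Pi.single a 1, j) : Edge d L) ∉
      TPlaq.tbonds ((v, j, a) : TPlaq d L) := by
    refine not_mem_tbonds_of_site hja ?_ ?_
    · rw [hs]; intro h
      exact single_add_single_ne_zero hL i a (by rw [h, hv]; exact neg_add_cancel _)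
    · rw [hs, hv0]; exact single_ne_zero hL2 i
  rw [integral_mul_reZpow_holT (v + Pi.single i 1, j, a) _ (holT_lat_mulSingle_thd hL2 hja)
    (G := fun U => reZpow η₀ (holT L (bot i j a) U) * reZpow η₁ (holT L (v, i, a) U) *
        reZpow η₂ (holT L (v + Pi.single j 1, i, a) U) * reZpow η₃ (holT L (v, j, a) U))
    ((((cF η₀ (bot i j a)).mul (cF η₁ (v, i, a))).mul (cF η₂ (v + Pi.single j 1, i, a))).mul
      (cF η₃ (v, j, a)))
    (fun U => bmul (bmul (bmul (bF η₀ (bot i j a) U) (bF η₁ (v, i, a) U))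
      (bF η₂ (v + Pi.single j 1, i, a) U)) (bF η₃ (v, j, a) U))
    (fun z U => by simp only [holT_mulSingle_of_not_mem hb0, holT_mulSingle_of_not_mem hb1,
      holT_mulSingle_of_not_mem hb2, holT_mulSingle_of_not_mem hb3]) h₄, I2]
  norm_num

/-! ## §3. The cube moment -/

/-- `Re(w)` for `w` on the circle is `(w + w⁻¹)/2`. [folklore] -/
theorem re_eq_add_inv (w : Circle) : (((w : ℂ).re : ℝ) : ℂ) = ((w : ℂ) + (w : ℂ)⁻¹) / 2 := by
  rw [← Circle.coe_inv, Circle.coe_inv_eq_conj, Complex.add_conj]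
  push_cast
  ring

/-- **THE CUBE MOMENT**: `E[Re U_top · Re U_bot · ∏_{four lateral faces} Re U_ℓ] = 1/32`
(`= 2^{-(4t+1)}` at `t = 1`). [folklore] -/
theorem integral_cube_eq (hL : 3 ≤ L) (hij : i < j) (hai : a ≠ i) (haj : a ≠ j) :
    ∫ U, cosT L (top i j) U * cosT L (bot i j a) U * cosT L (-Pi.single a 1, i, a) U *
        cosT L (-Pi.single a 1 + Pi.single j 1, i, a) U * cosT L (-Pi.single a 1, j, a) U *
        cosT L (-Pi.single a 1 + Pi.single i 1, j, a) U ∂(zdHaar d Circle) = 1 / 32 := by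
  -- pass to the complex integral
  have key : ∫ U, ((cosT L (top i j) U * cosT L (bot i j a) U * cosT L (-Pi.single a 1, i, a) U *
        cosT L (-Pi.single a 1 + Pi.single j 1, i, a) U * cosT L (-Pi.single a 1, j, a) U *
        cosT L (-Pi.single a 1 + Pi.single i 1, j, a) U : ℝ) : ℂ) ∂(zdHaar d Circle) = 1 / 32 := by
    -- pointwise: `Re U_top ∏ Re U_f = (∏_f Re U_f · U_f^{η_f} + ∏_f Re U_f · U_f^{-η_f}) / 2`
    have hpt : ∀ U : ZdGaugeConfig d Circle,
        ((cosT L (top i j) U * cosT L (bot i j a) U * cosT L (-Pi.single a 1, i, a) U *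
          cosT L (-Pi.single a 1 + Pi.single j 1, i, a) U * cosT L (-Pi.single a 1, j, a) U *
          cosT L (-Pi.single a 1 + Pi.single i 1, j, a) U : ℝ) : ℂ) =
        (1 / 2 : ℂ) * (reZpow 1 (holT L (bot i j a) U) * reZpow (-1) (holT L (-Pi.single a 1, i, a) U) *
            reZpow 1 (holT L (-Pi.single a 1 + Pi.single j 1, i, a) U) *
            reZpow 1 (holT L (-Pi.single a 1, j, a) U) *
            reZpow (-1) (holT L (-Pi.single a 1 + Pi.single i 1, j, a) U)) +
        (1 / 2 : ℂ) * (reZpow (-1) (holT L (bot i j a) U) * reZpow 1 (holT L (-Pi.single a 1, i, a) U) *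
            reZpow (-1) (holT L (-Pi.single a 1 + Pi.single j 1, i, a) U) *
            reZpow (-1) (holT L (-Pi.single a 1, j, a) U) *
            reZpow 1 (holT L (-Pi.single a 1 + Pi.single i 1, j, a) U)) := by
      intro U
      simp only [cosT, reZpow, zpow_neg, zpow_one]
      push_cast
      rw [re_eq_add_inv (holT L (top i j) U), holT_top_eq_prod i j a U]
      simp only [Circle.coe_mul, Circle.coe_inv]
      have h1 := Circle.coe_ne_zero (holT L (bot i j a) U)
      have h2 := Circle.coe_ne_zero (holT L (-Pi.single a 1, i, a) U)
      have h3 := Circle.coe_ne_zero (holT L (-Pi.single a 1 + Pi.single j 1, i, a) U)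
      have h4 := Circle.coe_ne_zero (holT L (-Pi.single a 1, j, a) U)
      have h5 := Circle.coe_ne_zero (holT L (-Pi.single a 1 + Pi.single i 1, j, a) U)
      field_simp
    simp_rw [hpt]
    have c5 : ∀ (η₀ η₁ η₂ η₃ η₄ : ℤ), Continuous fun U : ZdGaugeConfig d Circle =>
        reZpow η₀ (holT L (bot i j a) U) * reZpow η₁ (holT L (-Pi.single a 1, i, a) U) *
          reZpow η₂ (holT L (-Pi.single a 1 + Pi.single j 1, i, a) U) *
          reZpow η₃ (holT L (-Pi.single a 1, j, a) U) *
          reZpow η₄ (holT L (-Pi.single a 1 + Pi.single i 1, j, a) U) := fun _ _ _ _ _ =>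
      (((((continuous_reZpow _).comp (continuous_holT L _)).mul
        ((continuous_reZpow _).comp (continuous_holT L _))).mul
        ((continuous_reZpow _).comp (continuous_holT L _))).mul
        ((continuous_reZpow _).comp (continuous_holT L _))).mul
        ((continuous_reZpow _).comp (continuous_holT L _))
    have hint : ∀ (η₀ η₁ η₂ η₃ η₄ : ℤ), Integrable (fun U : ZdGaugeConfig d Circle =>
        reZpow η₀ (holT L (bot i j a) U) * reZpow η₁ (holT L (-Pi.single a 1, i, a) U) *
          reZpow η₂ (holT L (-Pi.single a 1 + Pi.single j 1, i, a) U) *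
          reZpow η₃ (holT L (-Pi.single a 1, j, a) U) *
          reZpow η₄ (holT L (-Pi.single a 1 + Pi.single i 1, j, a) U)) (zdHaar d Circle) := by
      intro η₀ η₁ η₂ η₃ η₄
      refine Integrable.of_bound (c5 η₀ η₁ η₂ η₃ η₄).measurable.aestronglyMeasurable 1
        (Eventually.of_forall fun U => ?_)
      have b := fun (η : ℤ) (q : TPlaq d L) => norm_reZpow_le η (holT L q U)
      simp only [norm_mul]
      calc ‖reZpow η₀ (holT L (bot i j a) U)‖ * ‖reZpow η₁ (holT L (-Pi.single a 1, i, a) U)‖ *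
            ‖reZpow η₂ (holT L (-Pi.single a 1 + Pi.single j 1, i, a) U)‖ *
            ‖reZpow η₃ (holT L (-Pi.single a 1, j, a) U)‖ *
            ‖reZpow η₄ (holT L (-Pi.single a 1 + Pi.single i 1, j, a) U)‖ ≤ 1 * 1 * 1 * 1 * 1 := by
            gcongr <;> exact b _ _
        _ = 1 := by ring
    rw [integral_add ((hint _ _ _ _ _).const_mul _) ((hint _ _ _ _ _).const_mul _),
      integral_const_mul, integral_const_mul,
      integral_prod_reZpow_five hL hij hai haj (Or.inl rfl) (Or.inr rfl) (Or.inl rfl) (Or.inl rfl)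
        (Or.inr rfl),
      integral_prod_reZpow_five hL hij hai haj (Or.inr rfl) (Or.inl rfl) (Or.inr rfl) (Or.inr rfl)
        (Or.inl rfl)]
    norm_num
  have h := integral_complex_ofReal (μ := zdHaar d Circle)
    (f := fun U => cosT L (top i j) U * cosT L (bot i j a) U * cosT L (-Pi.single a 1, i, a) U *
        cosT L (-Pi.single a 1 + Pi.single j 1, i, a) U * cosT L (-Pi.single a 1, j, a) U *
        cosT L (-Pi.single a 1 + Pi.single i 1, j, a) U)
  rw [key] at h
  have h2 : (((∫ U, cosT L (top i j) U * cosT L (bot i j a) U * cosT L (-Pi.single a 1, i, a) U *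
        cosT L (-Pi.single a 1 + Pi.single j 1, i, a) U * cosT L (-Pi.single a 1, j, a) U *
        cosT L (-Pi.single a 1 + Pi.single i 1, j, a) U ∂(zdHaar d Circle) : ℝ) : ℂ) =
      ((1 / 32 : ℝ) : ℂ)) := by
    rw [← h]; push_cast; ring
  exact Complex.ofReal_injective h2

end Peel

end Summit.Ventures.LatticeQCDFlow.Theory2.Lattice.U1Torus

end
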